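import Summits.ResolutionOfSingularities.ResolutionOfSingularities.Theorems.RadicialJungCleanModelsMonomializationOfThm11
import Summits.ResolutionOfSingularities.ResolutionOfSingularities.Theorems.RadicialJungCleanModelsCleanLU3CompositeFrame
import HarnessLib

/-!
# (C-div) frame along a divisorial coarsening — from CP 2019 Thm. 1.1 (i)–(iii), no CJS hypothesis

Route `RadicialJung`, crux `CleanModels` (stmt-ResolutionOfSingularities-15917), line `Sketch`, sub-line (C-div) of the research
residual: the tree's theorem(s) of the same name WITHOUT the suffix `_thm11`, with the embedded-resolution HYPOTHESIS `hEmb` (CJS 2020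
Cor. 1.5 shape; skeleton stub `stub_cjs2020Thm14` = F-32) REPLACED by the typed verbatim Cossart–Piltant 2019 Thm. 1.1 (i)–(iii)
`CP2019.CossartPiltant2019Thm11`, through the doubling trick (`Doubling.hEmb_zeroLocus_of_thm11`,
`exists_localRing_monomial_of_thm11_dim`).  Proof bodies are the tree's, verbatim — credit to the original files (seat res-B-lead-1 and
its workers); only the binder and the one threaded call differ.  OURS; nothing here proves resolution in characteristic `p`.
-/

noncomputable section

set_option linter.dupNamespace false -- mandated namespace of this single-conjunct summit

open IsLocalRing AlgebraicGeometry CategoryTheory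
open Literature.AlgebraicGeometry.Resolution

namespace Summit.ResolutionOfSingularities.ResolutionOfSingularities.Theorems.RadicialJung.CleanModels

variable {K : Type} [Field K]

/-- **The frame along a divisorial coarsening** (mod CP 2019 Thm. 1.1 (i)–(iii), `h11`): see the module docstring of the original file.  Output: a finitely generated model `A′ ⊇ A` along `O`
whose local ring `R′ ⊇ locAtCentre A O` is regular of dimension 3 with a regular system of parameters `(t, t₂, t₃)`, `v₁ t < 1`,
`v₁ t₂ = v₁ t₃ = 1`. [cite: CossartJannsenSaito2020, Cor. 1.5, p. 7] -/
theorem exists_frame_of_coarsening_thm11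
    (h11 : Literature.AlgebraicGeometry.CossartPiltant200819.CP2019.CossartPiltant2019Thm11.{0})
    (k : Type) [Field k] [Algebra k K]
    (O : ValuationSubring K) (A : Subalgebra k K) (hAO : A.toSubring ≤ O.toSubring) (hAfg : A.FG)
    (hfrac : IsFractionRing A K)
    (hreg : IsRegularLocalRing (locAtCentre A.toSubring O))
    (hdim3 : ringKrullDim (locAtCentre A.toSubring O) = 3)
    (hzd : ∀ (T : Subring K) (hT : T ≤ O.toSubring), A.toSubring ≤ T → (subringCentre T O hT).IsMaximal)
    (O₁ : ValuationSubring K) (hOO₁ : O ≤ O₁)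
    (hloc : locAtCentre (locAtCentre A.toSubring O) O₁ = O₁.toSubring)
    (t₀ : K) (ht₀ : t₀ ∈ locAtCentre A.toSubring O) (ht₀0 : t₀ ≠ 0) (hv₁t₀ : O₁.valuation t₀ < 1) :
    ∃ (A' : Subalgebra k K), A ≤ A' ∧ A'.FG ∧ ∃ (hA'O : A'.toSubring ≤ O.toSubring),
      IsRegularLocalRing (locAtCentre A'.toSubring O) ∧ ringKrullDim (locAtCentre A'.toSubring O) = 3 ∧
      locAtCentre A.toSubring O ≤ locAtCentre A'.toSubring O ∧
      ∃ (t t₂ t₃ : K) (ht : t ∈ locAtCentre A'.toSubring O) (ht₂ : t₂ ∈ locAtCentre A'.toSubring O)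
        (ht₃ : t₃ ∈ locAtCentre A'.toSubring O),
        (haveI := isLocalRing_locAtCentre hA'O; maximalIdeal (locAtCentre A'.toSubring O)) =
          Ideal.span {⟨t, ht⟩, ⟨t₂, ht₂⟩, ⟨t₃, ht₃⟩} ∧
        O₁.valuation t < 1 ∧ O₁.valuation t₂ = 1 ∧ O₁.valuation t₃ = 1 := by
  classical
  haveI := hreg
  haveI : IsFractionRing A K := hfrac
  set S : Subring K := locAtCentre A.toSubring O with hSdef
  have hSO : S ≤ O.toSubring := locAtCentre_le hAO
  have hAS : A.toSubring ≤ S := le_locAtCentre A.toSubring O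
  haveI : IsDomain S := inferInstance
  -- `S` is excellent: a localisation of the finitely generated `k`-algebra `A`
  haveI : Algebra.FiniteType k A := (Subalgebra.fg_iff_finiteType A).mp hAfg
  have hexcA : IsExcellentRing A := isExcellentRing_of_finiteType_field k A
  haveI := isLocalization_locAtCentre (K := K) (O := O) hAO
  have hexcS : IsExcellentRing S :=
    IsExcellentRing.of_isLocalization (A := A.toSubring) (B := S) (subringCentre A.toSubring O hAO).primeCompl hexcA
  -- `dim A = 3`
  have hdimA : ringKrullDim A = 3 := by
    rw [← ringKrullDim_locAtCentre_eq_of_isMaximal A hAfg O hAO (hzd _ hAO le_rfl)]; exact hdim3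
  -- the element to monomialize
  let xR : S := ⟨t₀, ht₀⟩
  have hxR0 : xR ≠ 0 := fun h => ht₀0 (congrArg Subtype.val h)
  have hv₀t₀ : O.valuation t₀ < 1 := by
    have := valuation_lt_of_le_of_valuation_lt O O₁ hOO₁ (x := t₀) (y := 1) (by rw [map_one]; exact hv₁t₀)
    rwa [map_one] at this
  have hxRm : xR ∈ maximalIdeal S := (mem_maximalIdeal_locAtCentre_iff hAO xR).mpr hv₀t₀
  have hRO : ∀ r : S, algebraMap S K r ∈ O := fun r => hSO r.2
  have hRm : ∀ r : S, r ∈ maximalIdeal S ↔ O.valuation (algebraMap S K r) < 1 := fun r =>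
    mem_maximalIdeal_locAtCentre_iff hAO r
  -- MONOMIALIZE `t₀` along `O`
  obtain ⟨uu, -, huuO, R', _, _, _, hinj, hR'O, hR'm, hlow, hup, d, z, α, u, hu, hdimR', hspan, hfact⟩ :=
    exists_localRing_monomial_of_thm11_dim (n := 2) le_rfl h11 (R := S) (K := K) (E := K) Subtype.val_injective hexcS
      (by rw [hdim3]; rfl) O hRO hRm xR hxR0 hxRm
  let T : Subring K := (Algebra.adjoin S (uu : Set K)).toSubring
  have hTO : T ≤ O.toSubring := fun w hw => huuO w hw
  have hST : S ≤ T := fun w hw => (Algebra.adjoin S (uu : Set K)).algebraMap_mem (⟨w, hw⟩ : S)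
  have hTR : ∀ w ∈ T, w ∈ Set.range (algebraMap R' K) := fun w hw => hlow w hw
  obtain ⟨R₂, hR₂def⟩ : ∃ R₂ : Subring K, R₂ = locAtCentre T O := ⟨_, rfl⟩
  have hrange : (algebraMap R' K).range = R₂ := by
    rw [hR₂def]; exact range_eq_locAtCentre (algebraMap R' K) O T hTR hR'm hup
  obtain ⟨hreg₂, z₂, u₂, hz₂, hu₂K, hspan₂, hdim₂, hu₂⟩ :=
    regular_data_of_range_eq (algebraMap R' K) hinj R₂ hrange z hspan hdimR' u hu
  haveI := hreg₂
  have hTR₂ : T ≤ R₂ := by rw [hR₂def]; exact le_locAtCentre T O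
  have hSR₂ : S ≤ R₂ := hST.trans hTR₂
  have hR₂O : R₂ ≤ O.toSubring := by rw [hR₂def]; exact locAtCentre_le hTO
  -- `R₂` is a local blow-up of `S`, hence the local ring of a finitely generated model
  have hlb : IsLocalBlowup O S R₂ := by
    refine ⟨hSO, uu, fun w hw => huuO w (Algebra.subset_adjoin hw), ?_⟩
    rw [hR₂def]
    congr 1
    change (Algebra.adjoin S (uu : Set K)).toSubring = _
    rw [Algebra.adjoin_eq_ring_closure]
    congr 1
    ext w
    simp only [Set.mem_union, Set.mem_range, SetLike.mem_coe]
    constructor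
    · rintro (⟨r, rfl⟩ | hw)
      · exact Or.inl r.2
      · exact Or.inr hw
    · rintro (hw | hw)
      · exact Or.inl ⟨⟨w, hw⟩, rfl⟩
      · exact Or.inr hw
  obtain ⟨A', hA'O, hAA', hA'fg, hR₂A'⟩ := exists_model_of_isLocalBlowup (A := A) (A₁ := A) le_rfl hAfg hlb
  -- dimension 3, hence `d = 3`
  have hdimR₂ : ringKrullDim R₂ = 3 := by
    rw [hR₂A', ringKrullDim_locAtCentre_eq_of_isMaximal A' hA'fg O hA'O (hzd _ hA'O (fun w hw => hAA' hw)),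
      ringKrullDim_eq_of_fg_of_le hAfg hA'fg hAA', hdimA]
  have hd3 : d = 3 := by
    have h := hdim₂; rw [hdimR₂] at h; exact_mod_cast h.symm
  subst hd3
  have hd' : (maximalIdeal R₂).spanFinrank = 3 := by
    have h := IsRegularLocalRing.spanFinrank_maximalIdeal (R := R₂)
    rw [hdimR₂] at h
    exact_mod_cast h
  -- `O₁`-values: `locAtCentre R₂ O₁ = O₁`
  have hR₂O₁ : R₂ ≤ O₁.toSubring := fun w hw => hOO₁ (hR₂O hw)
  have hloc₂ : locAtCentre R₂ O₁ = O₁.toSubring := by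
    apply le_antisymm (locAtCentre_le hR₂O₁)
    rw [← hloc]; exact locAtCentre_mono O₁ hSR₂
  have hvle : ∀ i, O₁.valuation ((z₂ i : R₂) : K) ≤ 1 := fun i => (O₁.valuation_le_one_iff _).mpr (hR₂O₁ (z₂ i).2)
  -- some parameter lies in the centre of `O₁` (else `t₀` would be an `O₁`-unit)
  have hex : ∃ i, O₁.valuation ((z₂ i : R₂) : K) < 1 := by
    by_contra hnone
    push Not at hnone
    have hall : ∀ i, O₁.valuation ((z₂ i : R₂) : K) = 1 := fun i => le_antisymm (hvle i) (hnone i)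
    have hu₂v : O₁.valuation ((u₂ : R₂) : K) = 1 := by
      obtain ⟨w, hw⟩ := hu₂
      apply le_antisymm ((O₁.valuation_le_one_iff _).mpr (hR₂O₁ u₂.2))
      have h1 : O₁.valuation (((w : R₂) : K) * (((w⁻¹ : R₂ˣ) : R₂) : K)) = 1 := by
        rw [← Subring.coe_mul, Units.mul_inv]; exact map_one _
      rw [map_mul] at h1
      have hle' : O₁.valuation ((((w⁻¹ : R₂ˣ) : R₂) : K)) ≤ 1 := (O₁.valuation_le_one_iff _).mpr (hR₂O₁ ((w⁻¹ : R₂ˣ) : R₂).2)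
      rw [← hw]
      calc (1 : _) = O₁.valuation ((w : R₂) : K) * O₁.valuation ((((w⁻¹ : R₂ˣ) : R₂) : K)) := h1.symm
        _ ≤ O₁.valuation ((w : R₂) : K) * 1 := by gcongr
        _ = _ := mul_one _
    have ht₀eq : t₀ = ((u₂ : R₂) : K) * ∏ i, ((z₂ i : R₂) : K) ^ α i := by
      have h4 : algebraMap R' K (u * ∏ i, z i ^ α i) = (u₂ : K) * ∏ i, (z₂ i : K) ^ α i := by
        rw [map_mul, map_prod, ← hu₂K]
        simp_rw [map_pow, ← hz₂]
      rw [← h4, ← hfact]; rfl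
    have : O₁.valuation t₀ = 1 := by
      rw [ht₀eq, map_mul, map_prod, hu₂v, one_mul]
      exact Finset.prod_eq_one fun i _ => by rw [map_pow, hall i, one_pow]
    rw [this] at hv₁t₀
    exact lt_irrefl _ hv₁t₀
  obtain ⟨i₁, hi₁⟩ := hex
  have huniq : ∀ j, j ≠ i₁ → O₁.valuation ((z₂ j : R₂) : K) = 1 := by
    intro j hj
    by_contra hne
    have hlt : O₁.valuation ((z₂ j : R₂) : K) < 1 := lt_of_le_of_ne (hvle j) hne
    exact hj (at_most_one_parameter_in_coarse_centre O₁ R₂ hR₂O₁ hloc₂ hd' z₂ hspan₂ hlt hi₁)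
  -- assemble, with the model `A'`
  subst hR₂A'
  have hrange3 : Set.range z₂ = {z₂ 0, z₂ 1, z₂ 2} := by
    ext y
    simp only [Set.mem_range, Set.mem_insert_iff, Set.mem_singleton_iff]
    constructor
    · rintro ⟨m, rfl⟩
      fin_cases m
      · exact Or.inl rfl
      · exact Or.inr (Or.inl rfl)
      · exact Or.inr (Or.inr rfl)
    · rintro (rfl | rfl | rfl)
      exacts [⟨0, rfl⟩, ⟨1, rfl⟩, ⟨2, rfl⟩]
  rw [hrange3] at hspan₂
  refine ⟨A', hAA', hA'fg, hA'O, hreg₂, hdimR₂, hSR₂, ?_⟩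
  fin_cases i₁
  · exact ⟨_, _, _, (z₂ 0).2, (z₂ 1).2, (z₂ 2).2, hspan₂.symm, hi₁, huniq 1 (by decide), huniq 2 (by decide)⟩
  · refine ⟨_, _, _, (z₂ 1).2, (z₂ 0).2, (z₂ 2).2, ?_, hi₁, huniq 0 (by decide), huniq 2 (by decide)⟩
    rw [← hspan₂, Set.insert_comm]
  · refine ⟨_, _, _, (z₂ 2).2, (z₂ 0).2, (z₂ 1).2, ?_, hi₁, huniq 0 (by decide), huniq 1 (by decide)⟩
    rw [← hspan₂, Set.pair_comm (z₂ 1) (z₂ 2), Set.insert_comm (z₂ 0) (z₂ 2)]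


end Summit.ResolutionOfSingularities.ResolutionOfSingularities.Theorems.RadicialJung.CleanModels

end
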